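import Summits.PneNP.PneNP.Theorems.UniformMagnification.Negative.Pow2Stream

/-!
# Route UniformStream — uniform streaming witness, part 2: the update and accept machines

`UpdateTM.updTM`: on `boolPair st [b]` (the state doubled, separator `01`, then the bit) output
`st.take 1` — read the first doubled pair, then DRAIN the rest FOUR symbols per TM2 step — in
`(2|st| + 1) / 4 + 2` steps; `AcceptTM.accTM`: `st ↦ [st.headD false]` in `(|st| - 1) / 4 + 2` steps.
The multi-pop statements are what make the route's budget (`≥ |st|`, while the update input has length
`2|st| + 3`) attainable; one-symbol-per-step machines (e.g. compiled `SProg`s) cannot meet it.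
[Arora–Barak 2009, §1.2 (multi-tape machines; constant-factor speed-up)] [folklore]
-/

set_option linter.dupNamespace false -- `Summit.PneNP.PneNP.…`: summit = sub-problem (D-0017 single-conjunct layout)

namespace Summit.PneNP.PneNP.Theorems.UniformMagnification.Negative

open Turing Computability
open Literature.Computability.Complexity Literature.Computability.MetaComplexity
open Literature.Computability.Complexity.PairFstTM (initList_stk_self initList_stk_ne haltList_stk_self
  haltList_stk_ne)
open Literature.Computability.Complexity.TM2Comp (iterate_bind_succ)

/-! ### The update machine `M₁`: `boolPair st [b] ↦ st.take 1` -/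

namespace UpdateTM

/-- Phase labels: read the first pair, then drain. [folklore] -/
inductive Label
  | read
  | drain
  deriving DecidableEq, Fintype

/-- States: a popped symbol and a flag. [folklore] -/
abbrev State : Type := Option Bool × Bool

/-- The first two popped symbols form a doubled data pair `bb`. [folklore] -/
def pairEq : Option Bool → Option Bool → Bool
  | some b, some b' => b == b'
  | _, _ => false

/-- Pop into the first register (flag cleared). [folklore] -/
def popReg : State → Option Bool → State := fun _ a => (a, false)

/-- The program (see the module docstring). [folklore] -/
def updProg : Label → TM2.Stmt (fun _ : Stk => Bool) Label State
  | .read =>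
    TM2.Stmt.pop Stk.inp popReg <|
      TM2.Stmt.pop Stk.inp (fun v a => (v.1, pairEq v.1 a)) <|
        TM2.Stmt.branch (fun v => v.2)
          (TM2.Stmt.push Stk.out (fun v => v.1.getD false) <|
            TM2.Stmt.load (fun _ => (none, false)) <| TM2.Stmt.goto fun _ => Label.drain)
          (TM2.Stmt.load (fun _ => (none, false)) <| TM2.Stmt.goto fun _ => Label.drain)
  | .drain =>
    TM2.Stmt.pop Stk.inp popReg <| TM2.Stmt.pop Stk.inp popReg <|
      TM2.Stmt.pop Stk.inp popReg <| TM2.Stmt.pop Stk.inp popReg <|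
        TM2.Stmt.branch (fun v => v.1.isNone)
          (TM2.Stmt.load (fun _ => (none, false)) TM2.Stmt.halt)
          (TM2.Stmt.load (fun _ => (none, false)) <| TM2.Stmt.goto fun _ => Label.drain)

/-- The update machine. [folklore] -/
def updTM : FinTM2 where
  K := Stk
  kDecidableEq := inferInstance
  kFin := inferInstance
  k₀ := Stk.inp
  k₁ := Stk.out
  Γ := fun _ => Bool
  Λ := Label
  main := Label.read
  ΛFin := inferInstance
  σ := State
  initialState := (none, false)
  σFin := inferInstance
  Γk₀Fin := inferInstanceAs (Fintype Bool)
  m := updProg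

/-- Configurations of the update machine (registers cleared). [folklore] -/
def cfg (l : Option Label) (i o : List Bool) : updTM.Cfg :=
  ⟨l, (none, false), stk i o⟩

/-- `read` on a doubled pair `aa`: output `a`, switch to `drain`. [folklore] -/
theorem step_read_pair (a : Bool) (rest o : List Bool) :
    updTM.step (cfg (some .read) (a :: a :: rest) o) = some (cfg (some .drain) rest (a :: o)) := by
  show TM2.step updProg _ = _
  cases a <;> simp [cfg, TM2.step, updProg, TM2.stepAux, popReg, pairEq] <;> rfl

/-- `read` on the separator `01` (empty state): output nothing, switch to `drain`. [folklore] -/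
theorem step_read_sep (rest o : List Bool) :
    updTM.step (cfg (some .read) (false :: true :: rest) o) = some (cfg (some .drain) rest o) := by
  show TM2.step updProg _ = _
  simp [cfg, TM2.step, updProg, TM2.stepAux, popReg, pairEq]
  rfl

/-- `drain` discards four symbols. [folklore] -/
theorem step_drain_four (c₁ c₂ c₃ c₄ : Bool) (rest o : List Bool) :
    updTM.step (cfg (some .drain) (c₁ :: c₂ :: c₃ :: c₄ :: rest) o) =
      some (cfg (some .drain) rest o) := by
  show TM2.step updProg _ = _
  simp [cfg, TM2.step, updProg, TM2.stepAux, popReg]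
  rfl

/-- `drain` on at most three symbols: discard them and halt. [folklore] -/
theorem step_drain_short (r o : List Bool) (hr : r.length < 4) :
    updTM.step (cfg (some .drain) r o) = some (cfg none [] o) := by
  show TM2.step updProg _ = _
  rcases r with _ | ⟨c₁, _ | ⟨c₂, _ | ⟨c₃, _ | ⟨c₄, r⟩⟩⟩⟩
  · simp [cfg, TM2.step, updProg, TM2.stepAux, popReg]
    rfl
  · simp [cfg, TM2.step, updProg, TM2.stepAux, popReg]
    rfl
  · simp [cfg, TM2.step, updProg, TM2.stepAux, popReg]
    rfl
  · simp [cfg, TM2.step, updProg, TM2.stepAux, popReg]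
    rfl
  · simp only [List.length_cons] at hr; omega

/-- The `drain` phase empties the input stack, four symbols per step. [folklore] -/
theorem iterate_drain :
    ∀ (r o : List Bool),
      (flip bind updTM.step)^[r.length / 4 + 1] (some (cfg (some .drain) r o)) =
        some (cfg none [] o)
  | c₁ :: c₂ :: c₃ :: c₄ :: rest, o => by
    have h : (c₁ :: c₂ :: c₃ :: c₄ :: rest).length / 4 + 1 = (rest.length / 4 + 1) + 1 := by
      simp only [List.length_cons]; omega
    rw [h, iterate_bind_succ, step_drain_four]
    exact iterate_drain rest o
  | [], o => by
    rw [List.length_nil, Nat.zero_div, Nat.zero_add, Function.iterate_one]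
    exact step_drain_short [] o (by simp)
  | [c₁], o => by
    rw [show [c₁].length / 4 + 1 = 1 by simp, Function.iterate_one]
    exact step_drain_short [c₁] o (by simp)
  | [c₁, c₂], o => by
    rw [show [c₁, c₂].length / 4 + 1 = 1 by simp, Function.iterate_one]
    exact step_drain_short [c₁, c₂] o (by simp)
  | [c₁, c₂, c₃], o => by
    rw [show [c₁, c₂, c₃].length / 4 + 1 = 1 by simp, Function.iterate_one]
    exact step_drain_short [c₁, c₂, c₃] o (by simp)

/-- Number of steps on the state `st`. [folklore] -/
def steps (st : List Bool) : ℕ := (2 * st.length + 1) / 4 + 2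

/-- **The update machine computes `boolPair st [b] ↦ st.take 1`** in `steps st` steps. [folklore] -/
theorem iterate_steps (st : List Bool) (b : Bool) :
    (flip bind updTM.step)^[steps st] (some (cfg (some .read) (boolPair st [b]) [])) =
      some (cfg none [] (st.take 1)) := by
  cases st with
  | nil =>
    rw [show steps [] = 1 + 1 by simp [steps], iterate_bind_succ]
    change (flip bind updTM.step)^[1] (updTM.step (cfg (some .read) [false, true, b] [])) = _
    rw [step_read_sep]
    have := iterate_drain [b] []
    simpa using this
  | cons a t =>
    have hlen : steps (a :: t) = ((t.flatMap fun x => [x, x]) ++ [false, true, b]).length / 4 + 1 + 1 := by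
      simp only [steps, List.length_cons, List.length_append, List.length_flatMap,
        List.length_nil, List.map_const', List.sum_replicate, smul_eq_mul]
      omega
    have hin : boolPair (a :: t) [b] = a :: a :: ((t.flatMap fun x => [x, x]) ++ [false, true, b]) := by
      simp [boolPair, List.append_assoc]
    rw [hin, hlen, iterate_bind_succ, step_read_pair]
    exact iterate_drain _ [a]

/-- The initial configuration on `z`. [folklore] -/
theorem initList_eq (z : List Bool) : initList updTM z = cfg (some .read) z [] := by
  refine TM2.Cfg.mk.injEq _ _ _ _ _ _ |>.mpr ⟨rfl, rfl, ?_⟩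
  funext k
  cases k
  · exact initList_stk_self updTM z
  · exact initList_stk_ne updTM z (k := Stk.out) (fun h => Stk.noConfusion h)

/-- The halting configuration with output `o`. [folklore] -/
theorem haltList_eq (o : List Bool) : haltList updTM o = cfg none [] o := by
  refine TM2.Cfg.mk.injEq _ _ _ _ _ _ |>.mpr ⟨rfl, rfl, ?_⟩
  funext k
  cases k
  · exact haltList_stk_ne updTM o (k := Stk.inp) (fun h => Stk.noConfusion h)
  · exact haltList_stk_self updTM o

/-- The bundled update machine. [folklore] -/
def aux : TM2ComputableAux Bool Bool where
  tm := updTM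
  inputAlphabet := Equiv.refl Bool
  outputAlphabet := Equiv.refl Bool

/-- **Running time of `M₁`**: `boolPair st [b] ↦ st.take 1` within `(2|st|+1)/4 + 2` steps.
[folklore] -/
theorem outputsWithin (st : List Bool) (b : Bool) :
    aux.OutputsWithin (boolPair st [b]) (st.take 1) ((2 * st.length + 1) / 4 + 2) := by
  refine ⟨⟨⟨steps st, ?_⟩, le_rfl⟩⟩
  change (flip bind updTM.step)^[steps st] (some (initList updTM ((boolPair st [b]).map id))) =
    some (haltList updTM ((st.take 1).map id))
  rw [List.map_id, List.map_id, initList_eq, haltList_eq]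
  exact iterate_steps st b

end UpdateTM

/-! ### The accept machine `M₂`: `st ↦ [st.headD false]` -/

namespace AcceptTM

/-- Phase labels: read the head, then drain. [folklore] -/
inductive Label
  | read
  | drain
  deriving DecidableEq, Fintype

/-- The program (see the module docstring). [folklore] -/
def accProg : Label → TM2.Stmt (fun _ : Stk => Bool) Label (Option Bool)
  | .read =>
    TM2.Stmt.pop Stk.inp (fun _ a => a) <|
      TM2.Stmt.push Stk.out (fun v => v.getD false) <|
        TM2.Stmt.load (fun _ => none) <| TM2.Stmt.goto fun _ => Label.drain
  | .drain =>
    TM2.Stmt.pop Stk.inp (fun _ a => a) <| TM2.Stmt.pop Stk.inp (fun _ a => a) <|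
      TM2.Stmt.pop Stk.inp (fun _ a => a) <| TM2.Stmt.pop Stk.inp (fun _ a => a) <|
        TM2.Stmt.branch (fun v => v.isNone)
          (TM2.Stmt.load (fun _ => none) TM2.Stmt.halt)
          (TM2.Stmt.load (fun _ => none) <| TM2.Stmt.goto fun _ => Label.drain)

/-- The accept machine. [folklore] -/
def accTM : FinTM2 where
  K := Stk
  kDecidableEq := inferInstance
  kFin := inferInstance
  k₀ := Stk.inp
  k₁ := Stk.out
  Γ := fun _ => Bool
  Λ := Label
  main := Label.read
  ΛFin := inferInstance
  σ := Option Bool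
  initialState := none
  σFin := inferInstance
  Γk₀Fin := inferInstanceAs (Fintype Bool)
  m := accProg

/-- Configurations of the accept machine (register cleared). [folklore] -/
def cfg (l : Option Label) (i o : List Bool) : accTM.Cfg :=
  ⟨l, none, stk i o⟩

/-- `read` on a nonempty state: output its head. [folklore] -/
theorem step_read_cons (a : Bool) (rest o : List Bool) :
    accTM.step (cfg (some .read) (a :: rest) o) = some (cfg (some .drain) rest (a :: o)) := by
  show TM2.step accProg _ = _
  simp [cfg, TM2.step, accProg, TM2.stepAux]
  rfl

/-- `read` on the empty state: output `false`. [folklore] -/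
theorem step_read_nil (o : List Bool) :
    accTM.step (cfg (some .read) [] o) = some (cfg (some .drain) [] (false :: o)) := by
  show TM2.step accProg _ = _
  simp [cfg, TM2.step, accProg, TM2.stepAux]
  rfl

/-- `drain` discards four symbols. [folklore] -/
theorem step_drain_four (c₁ c₂ c₃ c₄ : Bool) (rest o : List Bool) :
    accTM.step (cfg (some .drain) (c₁ :: c₂ :: c₃ :: c₄ :: rest) o) =
      some (cfg (some .drain) rest o) := by
  show TM2.step accProg _ = _
  simp [cfg, TM2.step, accProg, TM2.stepAux]
  rfl

/-- `drain` on at most three symbols: discard them and halt. [folklore] -/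
theorem step_drain_short (r o : List Bool) (hr : r.length < 4) :
    accTM.step (cfg (some .drain) r o) = some (cfg none [] o) := by
  show TM2.step accProg _ = _
  rcases r with _ | ⟨c₁, _ | ⟨c₂, _ | ⟨c₃, _ | ⟨c₄, r⟩⟩⟩⟩
  · simp [cfg, TM2.step, accProg, TM2.stepAux]
    rfl
  · simp [cfg, TM2.step, accProg, TM2.stepAux]
    rfl
  · simp [cfg, TM2.step, accProg, TM2.stepAux]
    rfl
  · simp [cfg, TM2.step, accProg, TM2.stepAux]
    rfl
  · simp only [List.length_cons] at hr; omega

/-- The `drain` phase empties the input stack, four symbols per step. [folklore] -/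
theorem iterate_drain :
    ∀ (r o : List Bool),
      (flip bind accTM.step)^[r.length / 4 + 1] (some (cfg (some .drain) r o)) =
        some (cfg none [] o)
  | c₁ :: c₂ :: c₃ :: c₄ :: rest, o => by
    have h : (c₁ :: c₂ :: c₃ :: c₄ :: rest).length / 4 + 1 = (rest.length / 4 + 1) + 1 := by
      simp only [List.length_cons]; omega
    rw [h, iterate_bind_succ, step_drain_four]
    exact iterate_drain rest o
  | [], o => by
    rw [List.length_nil, Nat.zero_div, Nat.zero_add, Function.iterate_one]
    exact step_drain_short [] o (by simp)
  | [c₁], o => by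
    rw [show [c₁].length / 4 + 1 = 1 by simp, Function.iterate_one]
    exact step_drain_short [c₁] o (by simp)
  | [c₁, c₂], o => by
    rw [show [c₁, c₂].length / 4 + 1 = 1 by simp, Function.iterate_one]
    exact step_drain_short [c₁, c₂] o (by simp)
  | [c₁, c₂, c₃], o => by
    rw [show [c₁, c₂, c₃].length / 4 + 1 = 1 by simp, Function.iterate_one]
    exact step_drain_short [c₁, c₂, c₃] o (by simp)

/-- Number of steps on the state `st`. [folklore] -/
def steps (st : List Bool) : ℕ := (st.length - 1) / 4 + 2

/-- **The accept machine computes `st ↦ [st.headD false]`** in `steps st` steps. [folklore] -/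
theorem iterate_steps (st : List Bool) :
    (flip bind accTM.step)^[steps st] (some (cfg (some .read) st [])) =
      some (cfg none [] [st.headD false]) := by
  cases st with
  | nil =>
    rw [show steps [] = 1 + 1 by simp [steps], iterate_bind_succ, step_read_nil]
    have := iterate_drain [] [false]
    simpa using this
  | cons a t =>
    have hlen : steps (a :: t) = t.length / 4 + 1 + 1 := by
      simp only [steps, List.length_cons]; omega
    rw [hlen, iterate_bind_succ, step_read_cons]
    exact iterate_drain t [a]

/-- The initial configuration on `z`. [folklore] -/
theorem initList_eq (z : List Bool) : initList accTM z = cfg (some .read) z [] := by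
  refine TM2.Cfg.mk.injEq _ _ _ _ _ _ |>.mpr ⟨rfl, rfl, ?_⟩
  funext k
  cases k
  · exact initList_stk_self accTM z
  · exact initList_stk_ne accTM z (k := Stk.out) (fun h => Stk.noConfusion h)

/-- The halting configuration with output `o`. [folklore] -/
theorem haltList_eq (o : List Bool) : haltList accTM o = cfg none [] o := by
  refine TM2.Cfg.mk.injEq _ _ _ _ _ _ |>.mpr ⟨rfl, rfl, ?_⟩
  funext k
  cases k
  · exact haltList_stk_ne accTM o (k := Stk.inp) (fun h => Stk.noConfusion h)
  · exact haltList_stk_self accTM o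

/-- The bundled accept machine. [folklore] -/
def aux : TM2ComputableAux Bool Bool where
  tm := accTM
  inputAlphabet := Equiv.refl Bool
  outputAlphabet := Equiv.refl Bool

/-- **Running time of `M₂`**: `st ↦ [st.headD false]` within `(|st|-1)/4 + 2` steps. [folklore] -/
theorem outputsWithin (st : List Bool) :
    aux.OutputsWithin st [st.headD false] ((st.length - 1) / 4 + 2) := by
  refine ⟨⟨⟨steps st, ?_⟩, le_rfl⟩⟩
  change (flip bind accTM.step)^[steps st] (some (initList accTM (st.map id))) =
    some (haltList accTM ([st.headD false].map id))
  rw [List.map_id, List.map_id, initList_eq, haltList_eq]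
  exact iterate_steps st

end AcceptTM

end Summit.PneNP.PneNP.Theorems.UniformMagnification.Negative
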